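import Literature.Analysis.FluidPDE.CKNEpsilonRegularityHolds
import Literature.Analysis.FluidPDE.ClassicalSuitableRegionEnergy
import HarnessLib

/-!
# Module E of the local analyticity radius: the ε-regularity bound for the small-data core

Analysis/FluidPDE proofs-layer file (theorems only, no definitions, no named facts), a step of
the proof of the named fact
`Literature.Analysis.FluidPDE.bradshawGrujicKukavica2015_local_analyticity_radius`
(`NSLocalAnalyticityRadius.lean`; Bradshaw–Grujić–Kukavica, J. Differential Equations 259
(2015), Thm. 2.3; LMS Lecture Note Ser. 430 (2016), Thm. 2.3.1). The fact has been reduced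
(`bradshawGrujicKukavica2015_local_analyticity_radius_of_small`,
`NSLocalAnalyticityRadiusUnitScale.lean`) to a *small-data unit-scale core*: a classical solution
`(u, p)` of the Navier–Stokes equations on the open cylinder `(-δ, R²) × B(x₁, R)` with
`‖u(t)‖_{L³(B_R)} ≤ ε₀`, `‖p(t)‖_{L^{3/2}(B_R)} ≤ ε₀` for all times. The first step of the
engine proving the core is the **sup-norm bound of the velocity inside the cylinder**, which this
file derives from the tree's ε-regularity criterion (Lemarié-Rieusset 2016, Thm. 14.4 =
Caffarelli–Kohn–Nirenberg's Proposition 1 in the `L³ × L^{3/2}` variables, the tree's theorem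
`lemarieRieusset_epsilon_regularity_holds`):

* `forall_norm_le_of_small` — **there are absolute `ε₁, K > 0` such that for `0 < ε₀ ≤ ε₁`, every
  classical solution on `(-δ, R²) × B(x₁, R)` (`δ > 0`, `R ≥ 1`) with the two smallness bounds
  satisfies `‖u(t, x)‖ ≤ K √ε₀` for `1/16 ≤ t < R²`, `x ∈ B(x₁, R - 1)`.**

Proof: the pair is a classical solution on the open region (`IsClassicalNSSolutionOnRegion`),
hence a suitable weak solution there (`IsClassicalNSSolutionOnRegion.isSuitableWeakSolutionOn`,
CKN 1982 §2), hence satisfies the standing hypotheses of Lemarié-Rieusset's §14.3 on every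
parabolic cylinder compactly inside
(`IsSuitableWeakSolutionOn.isLRSuitableWeakSolutionOn_parabolicCylinder`). On the cylinder
`Q_{1/4}(t₀, x)` hanging from a top time `t₀ ∈ (t, t + 1/64)`, Tonelli and the slice bounds give
`∫∫ (|u|³ + |p|^{3/2}) ≤ (ε₀³ + ε₀^{3/2})/16 = λ³ (1/4)²` with `λ = (ε₀³ + ε₀^{3/2})^{1/3} ≤ 2√ε₀`,
so Thm. 14.4 (`ν = 1`, `q = 3`, force `0`) bounds `|u| ≤ 4 C₀ λ` a.e. on `Q_{1/8}(t₀, x) ∋ (t, x)`,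
and everywhere there by continuity.

## Mathlib / tree search

Tree: `lemarieRieusset_epsilon_regularity_holds`, `lemarieRieusset_epsilon_regularity_iff`
(`CKNEpsilonRegularityHolds/Proofs`),
`IsSuitableWeakSolutionOn.isLRSuitableWeakSolutionOn_parabolicCylinder`
(`RusinSverakSingularityStabilityEpsilon`), `IsClassicalNSSolutionOnRegion.isSuitableWeakSolutionOn`
(`ClassicalSuitableRegionEnergy`), `isClassicalNSSolutionOnRegion_iff_of_isOpen`,
`parabolicCylinder`; the a.e.-to-everywhere step is the argument of
`SereginSverak2009.forall_le_of_ae_le_of_continuousOn` (re-proved here in five lines to keep the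
imports small). Mathlib: `lintegral_prod_le`, `Measure.prod_restrict`, `Measure.volume_eq_prod`,
`lintegral_rpow_enorm_eq_rpow_eLpNorm'`, `eLpNorm_eq_eLpNorm'`.

## References

* Z. Bradshaw, Z. Grujić, I. Kukavica, J. Differential Equations 259 (2015), Thm. 2.3, §4
  (the `ε`-regularity input of the proof). [BradshawGrujicKukavica2015]
* P. G. Lemarié-Rieusset, *The Navier–Stokes Problem in the 21st Century*, CRC Press 2016,
  Thm. 14.4. [LemarieRieusset2016]
* L. Caffarelli, R. Kohn, L. Nirenberg, Comm. Pure Appl. Math. 35 (1982), Prop. 1.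
  [CaffarelliKohnNirenberg1982]
-/

noncomputable section

open MeasureTheory Set Function Filter Metric Real
open _root_.Topology
open scoped ENNReal NNReal ContDiff Laplacian InnerProductSpace RealInnerProductSpace

namespace Literature.Analysis.FluidPDE

/-! ### From a.e. bounds to pointwise bounds for continuous functions -/

/-- On an open set, an a.e. bound of a function continuous there holds at every point (the
failure set is open and null; Lebesgue measure charges non-empty open sets). [folklore] -/
theorem forall_le_of_ae_restrict_of_continuousOn {X : Type*} [TopologicalSpace X]
    [MeasurableSpace X] [OpensMeasurableSpace X] {μ : Measure X} [μ.IsOpenPosMeasure]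
    {U : Set X} (hU : IsOpen U) {f : X → ℝ} (hf : ContinuousOn f U) {M : ℝ}
    (h : ∀ᵐ z ∂μ.restrict U, f z ≤ M) : ∀ z ∈ U, f z ≤ M := by
  by_contra hcon
  push Not at hcon
  obtain ⟨z, hzU, hlt⟩ := hcon
  have hopen : IsOpen (U ∩ f ⁻¹' Ioi M) := hf.isOpen_inter_preimage hU isOpen_Ioi
  have hpos : 0 < μ (U ∩ f ⁻¹' Ioi M) := hopen.measure_pos μ ⟨z, hzU, hlt⟩
  have hnull : μ.restrict U {w | ¬f w ≤ M} = 0 := ae_iff.1 h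
  rw [Measure.restrict_apply' hU.measurableSet] at hnull
  have hsub : U ∩ f ⁻¹' Ioi M ⊆ {w | ¬f w ≤ M} ∩ U := fun w hw =>
    ⟨not_le.2 (mem_Ioi.1 hw.2), hw.1⟩
  exact absurd (nonpos_iff_eq_zero.1 ((measure_mono hsub).trans hnull.le)) hpos.ne'

/-! ### The smallness integral on a cylinder from the slice bounds -/

/-- `∫ ‖f‖ₑ^q ≤ a^q` from `‖f‖_{L^q} ≤ a` (`0 < q < ∞`, `0 ≤ a`). [folklore] -/
theorem lintegral_rpow_enorm_le_of_eLpNorm_le {α : Type*} [MeasurableSpace α] {μ : Measure α}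
    {F : Type*} [NormedAddCommGroup F] {f : α → F} {q a : ℝ} (hq : 0 < q) (ha : 0 ≤ a)
    (h : eLpNorm f (ENNReal.ofReal q) μ ≤ ENNReal.ofReal a) :
    ∫⁻ x, ‖f x‖ₑ ^ q ∂μ ≤ ENNReal.ofReal (a ^ q) := by
  have hq0 : ENNReal.ofReal q ≠ 0 := by simpa using hq
  rw [eLpNorm_eq_eLpNorm' hq0 ENNReal.ofReal_ne_top, ENNReal.toReal_ofReal hq.le] at h
  rw [lintegral_rpow_enorm_eq_rpow_eLpNorm' hq, ← ENNReal.ofReal_rpow_of_nonneg ha hq.le]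
  exact ENNReal.rpow_le_rpow h hq.le

/-- **The slice integral of the smallness quantity**: if `‖u(t)‖_{L³(B)} ≤ ε₀` and
`‖p(t)‖_{L^{3/2}(B)} ≤ ε₀` then `∫_B (‖u(t)‖³ + ‖p(t)‖^{3/2}) ≤ ε₀³ + ε₀^{3/2}`. [folklore] -/
theorem lintegral_cube_add_le_of_eLpNorm_le
    {u : EuclideanSpace ℝ (Fin 3) → EuclideanSpace ℝ (Fin 3)} {p : EuclideanSpace ℝ (Fin 3) → ℝ}
    {B : Set (EuclideanSpace ℝ (Fin 3))} {ε₀ : ℝ} (hε₀ : 0 ≤ ε₀)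
    (hum : AEMeasurable u (volume.restrict B))
    (hu : eLpNorm u 3 (volume.restrict B) ≤ ENNReal.ofReal ε₀)
    (hp : eLpNorm p (ENNReal.ofReal (3 / 2)) (volume.restrict B) ≤ ENNReal.ofReal ε₀) :
    ∫⁻ y in B, (‖u y‖ₑ ^ (3 : ℕ) + ‖p y‖ₑ ^ (3 / 2 : ℝ)) ≤
      ENNReal.ofReal (ε₀ ^ 3 + ε₀ ^ (3 / 2 : ℝ)) := by
  have hu' : eLpNorm u (ENNReal.ofReal 3) (volume.restrict B) ≤ ENNReal.ofReal ε₀ := by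
    rwa [show ENNReal.ofReal 3 = 3 by norm_num]
  have h1 := lintegral_rpow_enorm_le_of_eLpNorm_le (by norm_num : (0 : ℝ) < 3) hε₀ hu'
  have h2 := lintegral_rpow_enorm_le_of_eLpNorm_le (by norm_num : (0 : ℝ) < 3 / 2) hε₀ hp
  rw [lintegral_add_left' (hum.enorm.pow_const 3), ENNReal.ofReal_add (by positivity)
    (by positivity)]
  refine add_le_add ?_ h2
  have e : ∀ y, ‖u y‖ₑ ^ (3 : ℕ) = ‖u y‖ₑ ^ (3 : ℝ) := fun y => by
    rw [show (3 : ℝ) = ((3 : ℕ) : ℝ) by norm_num, ENNReal.rpow_natCast]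
  have e' : ε₀ ^ 3 = ε₀ ^ (3 : ℝ) := by
    rw [show (3 : ℝ) = ((3 : ℕ) : ℝ) by norm_num, Real.rpow_natCast]
  simp_rw [e]
  rw [e']
  exact h1

/-- **The space–time smallness integral on a cylinder inside the data cylinder.** If the slice
bounds hold for all `t ∈ (-δ, R²)` on `B(x₁, R)` and `Q_r(z₀) ⊆ (-δ, R²) × B(x₁, R)`, then
`∫∫_{Q_r(z₀)} (‖u‖³ + ‖p‖^{3/2}) ≤ (ε₀³ + ε₀^{3/2}) r²` (Tonelli). [folklore] -/
theorem lintegral_parabolicCylinder_cube_add_le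
    {u : ℝ → EuclideanSpace ℝ (Fin 3) → EuclideanSpace ℝ (Fin 3)}
    {p : ℝ → EuclideanSpace ℝ (Fin 3) → ℝ} {x₁ : EuclideanSpace ℝ (Fin 3)} {δ R ε₀ r : ℝ}
    (hε₀ : 0 ≤ ε₀)
    (hum : ∀ t ∈ Ioo (-δ) (R ^ 2), AEMeasurable (u t) (volume.restrict (ball x₁ R)))
    (hu3 : ∀ t ∈ Ioo (-δ) (R ^ 2), eLpNorm (u t) 3 (volume.restrict (ball x₁ R)) ≤
      ENNReal.ofReal ε₀)
    (hp32 : ∀ t ∈ Ioo (-δ) (R ^ 2), eLpNorm (p t) (ENNReal.ofReal (3 / 2))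
      (volume.restrict (ball x₁ R)) ≤ ENNReal.ofReal ε₀)
    {z₀ : ℝ × EuclideanSpace ℝ (Fin 3)}
    (hsub : parabolicCylinder r z₀ ⊆ Ioo (-δ) (R ^ 2) ×ˢ ball x₁ R)
    (hne : (parabolicCylinder r z₀).Nonempty) :
    ∫⁻ w in parabolicCylinder r z₀, (‖u w.1 w.2‖ₑ ^ (3 : ℕ) + ‖p w.1 w.2‖ₑ ^ (3 / 2 : ℝ)) ≤
      ENNReal.ofReal ((ε₀ ^ 3 + ε₀ ^ (3 / 2 : ℝ)) * r ^ 2) := by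
  -- the cylinder `(t₀ - r², t₀) × B(x₀, r)` sits in `(t₀ - r², t₀) × B(x₁, R)`
  obtain ⟨w₀, hw₀⟩ := hne
  have hT : Ioo (z₀.1 - r ^ 2) z₀.1 ⊆ Ioo (-δ) (R ^ 2) := by
    intro s hs
    have : (s, w₀.2) ∈ parabolicCylinder r z₀ := by
      rw [mem_parabolicCylinder] at hw₀ ⊢
      exact ⟨hs, hw₀.2⟩
    exact (hsub this).1
  have hB : ball z₀.2 r ⊆ ball x₁ R := by
    intro y hy
    have : (w₀.1, y) ∈ parabolicCylinder r z₀ := by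
      rw [mem_parabolicCylinder] at hw₀ ⊢
      exact ⟨hw₀.1, hy⟩
    exact (hsub this).2
  set F : ℝ × EuclideanSpace ℝ (Fin 3) → ℝ≥0∞ := fun w =>
    ‖u w.1 w.2‖ₑ ^ (3 : ℕ) + ‖p w.1 w.2‖ₑ ^ (3 / 2 : ℝ) with hF
  calc ∫⁻ w in parabolicCylinder r z₀, F w
      ≤ ∫⁻ w in Ioo (z₀.1 - r ^ 2) z₀.1 ×ˢ ball x₁ R, F w :=
        lintegral_mono_set (prod_mono le_rfl hB)
    _ = ∫⁻ w, F w ∂((volume.restrict (Ioo (z₀.1 - r ^ 2) z₀.1)).prod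
          (volume.restrict (ball x₁ R))) := by
        rw [Measure.prod_restrict, ← Measure.volume_eq_prod]
    _ ≤ ∫⁻ s in Ioo (z₀.1 - r ^ 2) z₀.1, ∫⁻ y in ball x₁ R, F (s, y) := lintegral_prod_le _
    _ ≤ ∫⁻ _ in Ioo (z₀.1 - r ^ 2) z₀.1, ENNReal.ofReal (ε₀ ^ 3 + ε₀ ^ (3 / 2 : ℝ)) := by
        refine setLIntegral_mono measurable_const fun s hs => ?_
        exact lintegral_cube_add_le_of_eLpNorm_le hε₀ (hum s (hT hs)) (hu3 s (hT hs))
          (hp32 s (hT hs))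
    _ = ENNReal.ofReal ((ε₀ ^ 3 + ε₀ ^ (3 / 2 : ℝ)) * r ^ 2) := by
        rw [setLIntegral_const, Real.volume_Ioo, ← ENNReal.ofReal_mul (by positivity)]
        congr 1
        ring_nf

/-! ### The velocity bound -/

/-- **Module E: the ε-regularity bound for the small-data core.** There are absolute constants
`ε₁, K > 0` such that: if `0 < ε₀ ≤ ε₁`, `δ > 0`, `R ≥ 1`, and `(u, p)` is a classical solution
of the Navier–Stokes equations (`ν = 1`, no force) on the open cylinder `(-δ, R²) × B(x₁, R)`
with `‖u(t)‖_{L³(B(x₁,R))} ≤ ε₀` and `‖p(t)‖_{L^{3/2}(B(x₁,R))} ≤ ε₀` for all `t ∈ (-δ, R²)`,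
then `‖u(t, x)‖ ≤ K √ε₀` for all `1/16 ≤ t < R²` and `x ∈ B(x₁, R - 1)` (Lemarié-Rieusset 2016,
Thm. 14.4 on the cylinders `Q_{1/4}(t₀, x)`, `t < t₀ < t + 1/64`, where
`∫∫ (|u|³ + |p|^{3/2}) ≤ (ε₀³ + ε₀^{3/2})/16 ≤ (2√ε₀)³ (1/4)²`).
[cite: LemarieRieusset2016, Thm. 14.4 p. 505] -/
theorem exists_forall_norm_le_of_small :
    ∃ ε₁ K : ℝ, 0 < ε₁ ∧ 0 < K ∧
      ∀ ⦃ε₀ : ℝ⦄, 0 < ε₀ → ε₀ ≤ ε₁ →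
      ∀ (x₁ : EuclideanSpace ℝ (Fin 3)) ⦃δ R : ℝ⦄, 0 < δ → 1 ≤ R →
      ∀ ⦃u : ℝ → EuclideanSpace ℝ (Fin 3) → EuclideanSpace ℝ (Fin 3)⦄
        ⦃p : ℝ → EuclideanSpace ℝ (Fin 3) → ℝ⦄,
        ContDiffOn ℝ ∞ (uncurry u) (Ioo (-δ) (R ^ 2) ×ˢ ball x₁ R) →
        ContDiffOn ℝ ∞ (uncurry p) (Ioo (-δ) (R ^ 2) ×ˢ ball x₁ R) →
        (∀ t ∈ Ioo (-δ) (R ^ 2), ∀ x ∈ ball x₁ R,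
          deriv (fun s => u s x) t + convect (u t) (u t) x = Δ (u t) x - gradient (p t) x) →
        (∀ t ∈ Ioo (-δ) (R ^ 2), ∀ x ∈ ball x₁ R, VectorCalculus.divergence (u t) x = 0) →
        (∀ t ∈ Ioo (-δ) (R ^ 2), eLpNorm (u t) 3 (volume.restrict (ball x₁ R)) ≤
          ENNReal.ofReal ε₀) →
        (∀ t ∈ Ioo (-δ) (R ^ 2), eLpNorm (p t) (ENNReal.ofReal (3 / 2))
          (volume.restrict (ball x₁ R)) ≤ ENNReal.ofReal ε₀) →
        ∀ t ∈ Ico (1 / 16 : ℝ) (R ^ 2), ∀ x ∈ ball x₁ (R - 1),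
          ‖u t x‖ ≤ K * Real.sqrt ε₀ := by
  obtain ⟨εL, C₀, hεL, hC₀, H⟩ :=
    lemarieRieusset_epsilon_regularity_iff.1 lemarieRieusset_epsilon_regularity_holds 1 3
      one_pos (by norm_num)
  refine ⟨min 1 (εL ^ 2 / 4), 8 * C₀, lt_min one_pos (by positivity), by positivity,
    fun ε₀ hε₀ hε₁ x₁ δ R hδ hR u p hu hp hns hdiv hu3 hp32 t ht x hx => ?_⟩
  have hε₀1 : ε₀ ≤ 1 := hε₁.trans (min_le_left _ _)
  have hε₀L : ε₀ ≤ εL ^ 2 / 4 := hε₁.trans (min_le_right _ _)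
  -- the classical solution on the open region and its suitability
  set O : Set (ℝ × EuclideanSpace ℝ (Fin 3)) := Ioo (-δ) (R ^ 2) ×ˢ ball x₁ R with hOdef
  have hO : IsOpen O := isOpen_Ioo.prod isOpen_ball
  have hsol : IsClassicalNSSolutionOnRegion O 1 0 u p := by
    rw [isClassicalNSSolutionOnRegion_iff_of_isOpen hO]
    refine ⟨hu, hp, fun s y hsy => ?_, fun s y hsy => hdiv s hsy.1 y hsy.2⟩
    simp only [one_smul, Pi.zero_apply, add_zero]
    exact hns s hsy.1 y hsy.2
  have hsws := hsol.isSuitableWeakSolutionOn hO one_pos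
  -- the cylinder `Q_{1/4}(t₀, x)` hanging from `t₀ ∈ (t, t + 1/64)`, `t₀ < R²`
  set t₀ : ℝ := min (t + 1 / 128) ((t + R ^ 2) / 2) with ht₀def
  have ht₀t : t < t₀ := lt_min (by linarith) (by linarith [ht.2])
  have ht₀R : t₀ < R ^ 2 := (min_le_right _ _).trans_lt (by linarith [ht.2])
  have ht₀t' : t₀ ≤ t + 1 / 128 := min_le_left _ _
  have hxR : dist x x₁ < R - 1 := mem_ball.1 hx
  set z₀ : ℝ × EuclideanSpace ℝ (Fin 3) := (t₀, x) with hz₀def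
  have hcl : closure (parabolicCylinder (1 / 4) z₀) ⊆ O := by
    refine (closure_parabolicCylinder_subset _ _).trans ?_
    rintro ⟨s, y⟩ ⟨hs, hy⟩
    simp only [hz₀def, mem_Icc, mem_closedBall] at hs hy
    refine ⟨⟨by linarith [ht.1], by linarith⟩, mem_ball.2 ?_⟩
    calc dist y x₁ ≤ dist y x + dist x x₁ := dist_triangle _ _ _
      _ < R := by linarith
  have hsubO : parabolicCylinder (1 / 4) z₀ ⊆ O := subset_closure.trans hcl
  obtain ⟨G, hLR⟩ := hsws.isLRSuitableWeakSolutionOn_parabolicCylinder (by norm_num) hcl 3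
  -- smallness on the cylinder
  set l : ℝ := 2 * Real.sqrt ε₀ with hldef
  have hl0 : 0 ≤ l := by positivity
  have hsq : Real.sqrt ε₀ ^ 2 = ε₀ := Real.sq_sqrt hε₀.le
  have hlε : l ≤ εL := by
    have h4 : 4 * ε₀ ≤ εL ^ 2 := by linarith
    have : l ^ 2 ≤ εL ^ 2 := by rw [hldef, mul_pow, hsq]; linarith
    exact (pow_le_pow_iff_left₀ hl0 hεL.le two_ne_zero).1 this
  have hum : ∀ s ∈ Ioo (-δ) (R ^ 2), AEMeasurable (u s) (volume.restrict (ball x₁ R)) := by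
    intro s hs
    have hc : ContinuousOn (u s) (ball x₁ R) := by
      have h1 : ContinuousOn (uncurry u) O := hu.continuousOn
      have h2 : ContinuousOn (fun y : EuclideanSpace ℝ (Fin 3) => (s, y)) (ball x₁ R) :=
        (continuous_const.prodMk continuous_id).continuousOn
      exact h1.comp h2 fun y hy => ⟨hs, hy⟩
    exact hc.aemeasurable measurableSet_ball
  have hne : (parabolicCylinder (1 / 4) z₀).Nonempty := by
    refine ⟨(t₀ - 1 / 32, x), ?_⟩
    rw [hz₀def, mem_parabolicCylinder]
    simp only [dist_self]
    exact ⟨⟨by norm_num, by norm_num⟩, by norm_num⟩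
  have hint : ∫⁻ w in parabolicCylinder (1 / 4) z₀,
      (‖u w.1 w.2‖ₑ ^ (3 : ℕ) + ‖p w.1 w.2‖ₑ ^ (3 / 2 : ℝ)) ≤
        ENNReal.ofReal (l ^ 3 * (1 / 4) ^ 2) := by
    refine (lintegral_parabolicCylinder_cube_add_le hε₀.le hum hu3 hp32 hsubO hne).trans
      (ENNReal.ofReal_le_ofReal (mul_le_mul_of_nonneg_right ?_ (by norm_num)))
    -- `ε₀³ + ε₀^{3/2} ≤ 2 ε₀^{3/2} ≤ 8 ε₀^{3/2} = (2√ε₀)³`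
    have h32 : ε₀ ^ (3 / 2 : ℝ) = Real.sqrt ε₀ ^ 3 := by
      rw [Real.sqrt_eq_rpow, ← Real.rpow_natCast, ← Real.rpow_mul hε₀.le]
      norm_num
    have hs1 : Real.sqrt ε₀ ≤ 1 := Real.sqrt_le_one.mpr hε₀1
    have hs0 : 0 ≤ Real.sqrt ε₀ := Real.sqrt_nonneg _
    have h3 : ε₀ ^ 3 ≤ Real.sqrt ε₀ ^ 3 :=
      calc ε₀ ^ 3 = (Real.sqrt ε₀ ^ 2) ^ 3 := by rw [hsq]
        _ = Real.sqrt ε₀ ^ 3 * Real.sqrt ε₀ ^ 3 := by ring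
        _ ≤ Real.sqrt ε₀ ^ 3 := mul_le_of_le_one_right (by positivity) (pow_le_one₀ hs0 hs1)
    rw [h32, hldef, mul_pow]
    nlinarith [pow_nonneg hs0 3]
  have hforce : ∫⁻ w in parabolicCylinder (1 / 4) z₀,
      ‖(0 : ℝ → EuclideanSpace ℝ (Fin 3) → EuclideanSpace ℝ (Fin 3)) w.1 w.2‖ₑ ^ (3 : ℝ) ≤
        ENNReal.ofReal (l ^ (2 * (3 : ℝ)) * (1 / 4 : ℝ) ^ (5 - 3 * (3 : ℝ))) := by
    simp
  have hbdd := H (parabolicCylinderOpens (1 / 4) z₀) 0 u p G hLR z₀ (1 / 4) l (by norm_num)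
    subset_rfl hl0 hlε hint hforce
  -- everywhere on `Q_{1/8}(t₀, x)` by continuity
  have hUopen : IsOpen (parabolicCylinder (1 / 4 / 2) z₀) := isOpen_parabolicCylinder _ _
  have hUO : parabolicCylinder (1 / 4 / 2) z₀ ⊆ O := by
    refine Subset.trans (fun w hw => ?_) hsubO
    rw [hz₀def, mem_parabolicCylinder] at hw ⊢
    exact ⟨⟨by nlinarith [hw.1.1], hw.1.2⟩, hw.2.trans (by norm_num)⟩
  have hcont : ContinuousOn (fun w : ℝ × EuclideanSpace ℝ (Fin 3) => ‖u w.1 w.2‖)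
      (parabolicCylinder (1 / 4 / 2) z₀) :=
    (hu.continuousOn.mono hUO).norm
  have hall := forall_le_of_ae_restrict_of_continuousOn hUopen hcont hbdd
  have hmem : ((t, x) : ℝ × EuclideanSpace ℝ (Fin 3)) ∈
      parabolicCylinder (1 / 4 / 2) z₀ := by
    rw [hz₀def, mem_parabolicCylinder]
    simp only [dist_self]
    exact ⟨⟨by linarith, ht₀t⟩, by norm_num⟩
  have := hall (t, x) hmem
  calc ‖u t x‖ ≤ C₀ * l / (1 / 4) := this
    _ = 8 * C₀ * Real.sqrt ε₀ := by rw [hldef]; ring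

end Literature.Analysis.FluidPDE
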